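import Literature.NumberTheory.Automorphic.BrandtXi
import HarnessLib

/-!
# Positivity of the Brandt weights `w_c = #O_L(I_c)ˣ / 2` from finiteness of the unit group

Topic `NumberTheory/Automorphic`; theorems only, about the tree's `Brandt.unitIndex` / `Brandt.weight`
(`Literature/NumberTheory/Automorphic/BrandtXi.lean`; Voight 41.1.3, Gross 1987 §1: `w_i = #R_iˣ/±1`).
The weights enter `ξ = Σ_i w_i φ_i²` (`Brandt.xi`, Pollack–Weston 2011 §2.1) and are counted with
`Nat.card`, whose junk value on an infinite unit group is `0`. We isolate the formal half of
"`w_c ≥ 1`": as soon as the unit group of the order is FINITE (the arithmetic input — true for orders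
in totally definite quaternion algebras, where units have reduced norm `1` and lie on a compact
quadric; not proved here) and `1 ≠ -1` in `D`, the units `±1` give `#Oˣ ≥ 2`, hence
`unitIndex O = #Oˣ / 2 ≥ 1`:

* `Brandt.unitIndex_pos` : `1 ∈ O`, `Oˣ` finite, `(1 : D) ≠ -1` ⇒ `0 < unitIndex O`;
* `Brandt.weight_pos` : the same for `weight O c = unitIndex (O_L(I_c))` (`1 ∈ O_L(I)` always);
* `Brandt.XiSetup.one_ne_neg_one` : `1 ≠ -1` in the algebra of any Brandt setup (a quaternion
  algebra over `ℚ` is a non-trivial `ℚ`-algebra), and `Brandt.XiSetup.weight_pos`.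

Written during the audit of the named fact `PollackWeston2011.thm_6_8_ellipticCurve` (triaged XL, not
discharged; see `PollackWestonCongruence.lean`): together with `BrandtEigenLine.lean` this reduces
"`ξ(E; N⁺, N⁻) ≥ 1` and is the honest `Σ w_i φ_i²`" to the two arithmetic inputs (finite unit groups;
one-dimensional rational eigenspace).

## References

* J. Voight, *Quaternion Algebras*, GTM 288 (2021), 41.1.3; Lemma 17.7.13 / §32.3 (finiteness of
  `Oˣ/ℤ_Fˣ` for definite orders) [Voight2021].
* B. H. Gross, *Heights and the special values of L-series* (1987), §1 [Gross1987].
-/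

noncomputable section

universe u

namespace Literature.NumberTheory.Automorphic

namespace Brandt

variable {D : Type u} [Ring D]

/-- The two-sided units of `O` counted by `unitIndex`, as a set: an instance of Mathlib's
`Set.mem_setOf_eq` (`Iff.rfl`), unused in the tree and kept only as a deprecated alias
(dedup-00687). [folklore] -/
@[deprecated Set.mem_setOf_eq (since := "2026-08-15")]
theorem mem_setOf_units_iff (O : Submodule ℤ D) (x : D) :
    x ∈ {x : D | x ∈ O ∧ ∃ y ∈ O, x * y = 1 ∧ y * x = 1} ↔
      x ∈ O ∧ ∃ y ∈ O, x * y = 1 ∧ y * x = 1 :=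
  Iff.rfl

/-- **`#Oˣ / 2 ≥ 1` for a finite unit group.** If `1 ∈ O`, the set of two-sided units of `O` is
finite, and `1 ≠ -1` in `D`, then `0 < unitIndex O` (the units `1, -1` are distinct, so
`Nat.card ≥ 2`). The finiteness hypothesis is where definiteness of the quaternion algebra enters
(Voight 2021, 41.1.3 with §17.7). [cite: Voight2021, 41.1.3] -/
theorem unitIndex_pos {O : Submodule ℤ D} (h1 : (1 : D) ∈ O)
    (hfin : {x : D | x ∈ O ∧ ∃ y ∈ O, x * y = 1 ∧ y * x = 1}.Finite) (hne : (1 : D) ≠ -1) :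
    0 < unitIndex O := by
  rw [unitIndex]
  set U := {x : D // x ∈ O ∧ ∃ y ∈ O, x * y = 1 ∧ y * x = 1}
  haveI : Finite U := hfin.to_subtype
  have hneg1 : (-1 : D) ∈ O := O.neg_mem h1
  let f : Fin 2 → U := fun k =>
    if k = 0 then ⟨1, h1, 1, h1, by rw [one_mul], by rw [one_mul]⟩
    else ⟨-1, hneg1, -1, hneg1, by rw [neg_mul_neg, one_mul], by rw [neg_mul_neg, one_mul]⟩
  have hf : Function.Injective f := by
    intro a b hab
    fin_cases a <;> fin_cases b
    · rfl
    · exact absurd (congrArg Subtype.val hab) (by simpa [f] using hne)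
    · exact absurd (congrArg Subtype.val hab) (by simpa [f] using fun h => hne h.symm)
    · rfl
  have h2 : 2 ≤ Nat.card U := by
    simpa using Nat.card_le_card_of_injective f hf
  exact Nat.div_pos h2 two_pos

/-- **Positivity of the Brandt weight** `w_c = #O_L(I_c)ˣ / 2` from finiteness of the unit group of
the left order (`1 ∈ O_L(I)` holds for every lattice `I`). [cite: Voight2021, 41.1.3] -/
theorem weight_pos {O : Submodule ℤ D} (c : ClassSet O)
    (hfin : {x : D | x ∈ leftOrder c.rep ∧ ∃ y ∈ leftOrder c.rep, x * y = 1 ∧ y * x = 1}.Finite)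
    (hne : (1 : D) ≠ -1) : 0 < weight O c :=
  unitIndex_pos (one_mem_leftOrder _) hfin hne

/-- In the quaternion algebra of a Brandt setup, `1 ≠ -1` (it is a non-zero algebra over `ℚ`, of
dimension `4`). [folklore] -/
theorem XiSetup.one_ne_neg_one {Nplus Nminus : ℕ} (S : XiSetup Nplus Nminus) :
    (1 : S.D) ≠ -1 := by
  haveI : Nontrivial S.D := Module.nontrivial_of_finrank_pos (R := ℚ)
    (by rw [IsQuaternionAlgebra.finrank_eq_four (K := ℚ) (D := S.D)]; norm_num)
  intro h
  have h2 : (2 : S.D) = 0 := by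
    have : (1 : S.D) + 1 = 0 := by
      nth_rw 2 [h]
      exact add_neg_cancel 1
    rw [← this, one_add_one_eq_two]
  have h2' : algebraMap ℚ S.D 2 = 0 := by rw [map_ofNat, h2]
  rw [map_eq_zero_iff _ (algebraMap ℚ S.D).injective] at h2'
  exact two_ne_zero h2'

/-- **The weights of a Brandt setup are positive as soon as the unit groups are finite**: for a setup
`S` of type `(N⁺, N⁻)` and a class `c`, if `O_L(I_c)ˣ` is finite then `0 < weight S.O c`. (Finiteness
is automatic for the totally definite `S.D` — units of an order have reduced norm `1` and form a
discrete subset of a compact quadric — but that arithmetic input is not proved here.)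
[cite: Voight2021, 41.1.3] -/
theorem XiSetup.weight_pos {Nplus Nminus : ℕ} (S : XiSetup Nplus Nminus) (c : ClassSet S.O)
    (hfin : {x : S.D | x ∈ leftOrder c.rep ∧
      ∃ y ∈ leftOrder c.rep, x * y = 1 ∧ y * x = 1}.Finite) :
    0 < weight S.O c :=
  Brandt.weight_pos c hfin S.one_ne_neg_one

end Brandt

end Literature.NumberTheory.Automorphic

end
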